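import Mathlib
import Literature.NumberTheory.Sieve.GreenTao2006RestrictionEstimate
import HarnessLib

/-!
# Crux `DigitPolyUniformity` (stmt-QuantumAdvantage-1392), line `Sketch` — cycle 6 (seat c6):
# Stub C, simultaneous inhomogeneous approximation in `ℤ/M` (finite Kronecker via the Fejér kernel)

Stub `stub_kronecker` of the cycle-6 section of `Cruxes/DigitPolyUniformity/Lines/SketchLAR.lean` (the lead's stub).
In the cyclic group `ℤ/M`, let `t : ι → ℤ` have no relation `Σ c_i t_i ≡ 0 (mod M)` with `0 < ‖c‖_∞ < L`, and let
`#ι < 4δ²L`.  Then for every target `τ : ι → ℝ` some multiple `a·t`, `a < M`, satisfies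
`‖a t_i / M − τ_i‖_{ℝ/ℤ} ≤ δ` for all `i`.

Proof (Weyl/Fejér).  With the Dirichlet kernel `D(x) = Σ_{j<L} e(jx)` and `x_i(a) = a t_i/M − τ_i`, the weights
`W_s(a) = ‖∏_{i∈s} D(x_i(a))‖²` satisfy the exact TWISTED MASS identity (`twisted_mass`, by induction on `s`): for
`c` vanishing on `s` with `‖c‖_∞ < L`,
`Σ_{a<M} e(a·(Σ_i c_i t_i)/M) · W_s(a) = [c = 0] · M · L^{#s}` — expand `|D|² = Σ_{j,j'} e((j−j')x)`, use
orthogonality `Σ_{a<M} e(aN/M) = M·[M ∣ N]` (tree, `RamanujanSum.sum_range_fourierChar_div`) and the no-relation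
hypothesis (only diagonal terms survive).  Hence the total mass is `M L^{#ι}`, while the `a` at which `x_{i₀}(a)` is
`δ`-far from `ℤ` carry mass `≤ M L^{#ι−1}/(4δ²)` (`|D(x)| ≤ 1/(2‖x‖)`, tree `GreenTao2006.norm_sum_range_e_le_inv`).
If every `a` were bad for some `i`, `M L^{#ι} ≤ #ι · M L^{#ι−1}/(4δ²)`, i.e. `4δ²L ≤ #ι` — contradiction.
-/

noncomputable section

namespace Summit.QuantumAdvantage.DigitPolyUniformity.SketchLAR.Chirp

open Finset
open scoped ComplexConjugate
open Literature.NumberTheory.Sieve.LargeSieve (e e_add e_zero norm_e conj_e e_int)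
open Literature.NumberTheory.Sieve.GreenTao2006 (norm_sum_range_e_le_inv)
open Literature.NumberTheory.Sieve.RamanujanSum (sum_range_fourierChar_div)

namespace Kronecker

/-- `|D(x)|² = Σ_{j,j'<L} e((j − j')x)` for the Dirichlet kernel `D(x) = Σ_{j<L} e(jx)`, as complex numbers.
[folklore] -/
theorem normSq_dirichlet (L : ℕ) (x : ℝ) :
    (((‖∑ j ∈ range L, e (j * x)‖ ^ 2 : ℝ) : ℂ)) =
      ∑ j ∈ range L, ∑ j' ∈ range L, e (((j : ℝ) - j') * x) := by
  rw [Complex.ofReal_pow, ← Complex.mul_conj', map_sum, Finset.sum_mul_sum]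
  refine Finset.sum_congr rfl fun j _ => Finset.sum_congr rfl fun j' _ => ?_
  rw [conj_e, ← e_add]
  congr 1
  ring

/-- `e` of a product with an integer numerator: `e(a (N + N')/M) = e(a N/M) e(a N'/M)`. [folklore] -/
theorem e_mul_add_div (a N N' M : ℝ) : e (a * (N + N') / M) = e (a * N / M) * e (a * N' / M) := by
  rw [← e_add]; congr 1; ring

open Classical in
/-- **Twisted mass identity.** For `c : ι → ℤ` with `‖c‖_∞ < L` vanishing on `s`,
`Σ_{a<M} e(a (Σ_i c_i t_i)/M) ‖∏_{i∈s} D(a t_i/M − τ_i)‖² = [c = 0] · M · L^{#s}`, under the no-relation hypothesis.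
Induction on `s`: the base case is orthogonality of the additive characters of `ℤ/M`; the step expands `|D|²` and
absorbs `(j − j') t_{i₀}` into `c`. [folklore] -/
theorem twisted_mass {ι : Type*} [Fintype ι] (M : ℕ) (hM : 0 < M) (t : ι → ℤ) (τ : ι → ℝ) (L : ℕ)
    (hnorel : ∀ c : ι → ℤ, (∀ i, |c i| < L) → ((M : ℤ) ∣ ∑ i, c i * t i) → c = 0)
    (s : Finset ι) :
    ∀ c : ι → ℤ, (∀ i, |c i| < L) → (∀ i ∈ s, c i = 0) →
      ∑ a ∈ range M, e ((a : ℝ) * ((∑ i, c i * t i : ℤ) : ℝ) / M) *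
        (((‖∏ i ∈ s, ∑ j ∈ range L, e (j * ((a : ℝ) * t i / M - τ i))‖ ^ 2 : ℝ) : ℂ)) =
      if c = 0 then (M : ℂ) * (L : ℂ) ^ s.card else 0 := by
  induction s using Finset.induction_on with
  | empty =>
    intro c hcL _
    simp only [Finset.prod_empty, norm_one, one_pow, Complex.ofReal_one, mul_one, Finset.card_empty,
      pow_zero]
    rw [sum_range_fourierChar_div hM.ne' (∑ i, c i * t i)]
    by_cases hc : c = 0
    · rw [if_pos hc, if_pos]
      subst hc
      simp
    · rw [if_neg hc, if_neg]
      exact fun hdvd => hc (hnorel c hcL hdvd)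
  | insert i₀ s hi₀ ih =>
    intro c hcL hcs
    have hci₀ : c i₀ = 0 := hcs i₀ (Finset.mem_insert_self _ _)
    have hcs' : ∀ i ∈ s, c i = 0 := fun i hi => hcs i (Finset.mem_insert_of_mem hi)
    -- expand the new factor
    have hexp : ∀ a : ℕ,
        (((‖∏ i ∈ insert i₀ s, ∑ j ∈ range L, e (j * ((a : ℝ) * t i / M - τ i))‖ ^ 2 : ℝ) : ℂ)) =
          (∑ j ∈ range L, ∑ j' ∈ range L,
            e ((a : ℝ) * ((((j : ℤ) - j') * t i₀ : ℤ) : ℝ) / M) * e (-(((j : ℝ) - j') * τ i₀))) *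
          (((‖∏ i ∈ s, ∑ j ∈ range L, e (j * ((a : ℝ) * t i / M - τ i))‖ ^ 2 : ℝ) : ℂ)) := by
      intro a
      rw [Finset.prod_insert hi₀, norm_mul, mul_pow, Complex.ofReal_mul, normSq_dirichlet]
      congr 1
      refine Finset.sum_congr rfl fun j _ => Finset.sum_congr rfl fun j' _ => ?_
      rw [← e_add]
      congr 1
      push_cast
      ring
    -- the perturbed coefficient vectors
    set c' : ℕ → ℕ → ι → ℤ := fun j j' i => c i + if i = i₀ then (j : ℤ) - j' else 0 with hc'def
    have hc'sum : ∀ j j' : ℕ, ((∑ i, c' j j' i * t i : ℤ) : ℝ) =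
        ((∑ i, c i * t i : ℤ) : ℝ) + ((((j : ℤ) - j') * t i₀ : ℤ) : ℝ) := by
      intro j j'
      have : ∑ i, c' j j' i * t i = ∑ i, c i * t i + ((j : ℤ) - j') * t i₀ := by
        simp only [hc'def, add_mul, Finset.sum_add_distrib, ite_mul, zero_mul, Finset.sum_ite_eq',
          Finset.mem_univ, if_true]
      rw [this]; push_cast; ring
    have hc'L : ∀ j ∈ range L, ∀ j' ∈ range L, ∀ i, |c' j j' i| < L := by
      intro j hj j' hj' i
      simp only [hc'def]
      by_cases hi : i = i₀
      · subst hi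
        rw [hci₀, zero_add, if_pos rfl]
        rw [Finset.mem_range] at hj hj'
        rw [abs_lt]; constructor <;> omega
      · rw [if_neg hi, add_zero]; exact hcL i
    have hc's : ∀ j j', ∀ i ∈ s, c' j j' i = 0 := by
      intro j j' i hi
      have hne : i ≠ i₀ := fun h => hi₀ (h ▸ hi)
      simp only [hc'def, if_neg hne, add_zero, hcs' i hi]
    have hc'zero : ∀ j j' : ℕ, c' j j' = 0 ↔ c = 0 ∧ j = j' := by
      intro j j'
      constructor
      · intro h
        have h0 : c' j j' i₀ = 0 := by rw [h]; rfl
        simp only [hc'def, hci₀, zero_add, if_true, sub_eq_zero, Nat.cast_inj] at h0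
        refine ⟨?_, h0⟩
        funext i
        have hi : c' j j' i = 0 := by rw [h]; rfl
        simp only [hc'def, h0, sub_self, ite_self, add_zero] at hi
        exact hi
      · rintro ⟨rfl, rfl⟩
        funext i
        simp [hc'def]
    -- main computation
    calc ∑ a ∈ range M, e ((a : ℝ) * ((∑ i, c i * t i : ℤ) : ℝ) / M) *
          (((‖∏ i ∈ insert i₀ s, ∑ j ∈ range L, e (j * ((a : ℝ) * t i / M - τ i))‖ ^ 2 : ℝ) : ℂ))
        = ∑ a ∈ range M, ∑ j ∈ range L, ∑ j' ∈ range L, e (-(((j : ℝ) - j') * τ i₀)) *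
            (e ((a : ℝ) * ((∑ i, c' j j' i * t i : ℤ) : ℝ) / M) *
              (((‖∏ i ∈ s, ∑ j ∈ range L, e (j * ((a : ℝ) * t i / M - τ i))‖ ^ 2 : ℝ) : ℂ))) := by
          refine Finset.sum_congr rfl fun a _ => ?_
          rw [hexp a, Finset.sum_mul, Finset.mul_sum]
          refine Finset.sum_congr rfl fun j _ => ?_
          rw [Finset.sum_mul, Finset.mul_sum]
          refine Finset.sum_congr rfl fun j' _ => ?_
          rw [hc'sum, e_mul_add_div]
          ring
      _ = ∑ j ∈ range L, ∑ j' ∈ range L, e (-(((j : ℝ) - j') * τ i₀)) *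
            ∑ a ∈ range M, e ((a : ℝ) * ((∑ i, c' j j' i * t i : ℤ) : ℝ) / M) *
              (((‖∏ i ∈ s, ∑ j ∈ range L, e (j * ((a : ℝ) * t i / M - τ i))‖ ^ 2 : ℝ) : ℂ)) := by
          rw [Finset.sum_comm]
          refine Finset.sum_congr rfl fun j _ => ?_
          rw [Finset.sum_comm]
          refine Finset.sum_congr rfl fun j' _ => ?_
          rw [Finset.mul_sum]
      _ = ∑ j ∈ range L, ∑ j' ∈ range L, e (-(((j : ℝ) - j') * τ i₀)) *
            (if c' j j' = 0 then (M : ℂ) * (L : ℂ) ^ s.card else 0) := by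
          refine Finset.sum_congr rfl fun j hj => Finset.sum_congr rfl fun j' hj' => ?_
          rw [ih (c' j j') (hc'L j hj j' hj') (hc's j j')]
      _ = if c = 0 then (M : ℂ) * (L : ℂ) ^ (insert i₀ s).card else 0 := by
          simp_rw [hc'zero]
          by_cases hc : c = 0
          · simp only [hc, true_and, if_true]
            rw [Finset.card_insert_of_notMem hi₀, pow_succ]
            have : ∀ j ∈ range L, ∑ j' ∈ range L, e (-(((j : ℝ) - j') * τ i₀)) *
                (if j = j' then (M : ℂ) * (L : ℂ) ^ s.card else 0) = (M : ℂ) * (L : ℂ) ^ s.card := by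
              intro j hj
              simp_rw [mul_ite, mul_zero]
              rw [Finset.sum_ite_eq, if_pos hj, sub_self, zero_mul, neg_zero, e_zero, one_mul]
            rw [Finset.sum_congr rfl this, Finset.sum_const, Finset.card_range, nsmul_eq_mul]
            ring
          · simp [hc]

open Classical in
/-- **Untwisted mass.** `Σ_{a<M} ‖∏_{i∈s} D(a t_i/M − τ_i)‖² = M · L^{#s}` (the case `c = 0` of `twisted_mass`,
as a real identity). [folklore] -/
theorem mass_eq {ι : Type*} [Fintype ι] (M : ℕ) (hM : 0 < M) (t : ι → ℤ) (τ : ι → ℝ) (L : ℕ) (hL : 0 < L)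
    (hnorel : ∀ c : ι → ℤ, (∀ i, |c i| < L) → ((M : ℤ) ∣ ∑ i, c i * t i) → c = 0)
    (s : Finset ι) :
    ∑ a ∈ range M, ‖∏ i ∈ s, ∑ j ∈ range L, e (j * ((a : ℝ) * t i / M - τ i))‖ ^ 2 =
      (M : ℝ) * (L : ℝ) ^ s.card := by
  have h := twisted_mass M hM t τ L hnorel s 0 (fun i => by simpa using hL) (fun i _ => rfl)
  simp only [Pi.zero_apply, zero_mul, Finset.sum_const_zero, Int.cast_zero, mul_zero, zero_div,
    e_zero, one_mul, if_true] at h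
  exact_mod_cast h

end Kronecker

open Kronecker in
open Classical in
/-- **Stub C (finite Kronecker via the Fejér kernel).** In `ℤ/M`, if the integer vector `t` has no relation
`Σ c_i t_i ≡ 0 (mod M)` with `0 < ‖c‖_∞ < L`, and `#ι < 4δ²L`, then some multiple `a·t` is within `δ` (mod 1, after
division by `M`) of any prescribed target `τ`.  Proof: with `D(x) = Σ_{j<L} e(jx)`, the weights
`W(a) = ∏_i |D(a t_i/M − τ_i)|²` have total mass `M·L^{#ι}` (orthogonality; only diagonal terms survive by the
no-relation hypothesis) while the `a` with `‖a t_i/M − τ_i‖ > δ` carry mass `≤ M L^{#ι−1}/(4δ²)` for each `i`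
(`|D(x)| ≤ 1/(2‖x‖)`, tree `GreenTao2006.norm_sum_range_e_le_inv`). [folklore] -/
theorem stub_kronecker {ι : Type*} [Fintype ι] (M : ℕ) (hM : 0 < M)
    (t : ι → ℤ) (τ : ι → ℝ) (δ : ℝ) (hδ : 0 < δ) (L : ℕ)
    (hL : (Fintype.card ι : ℝ) < 4 * δ ^ 2 * L)
    (hnorel : ∀ c : ι → ℤ, (∀ i, |c i| < L) → ((M : ℤ) ∣ ∑ i, c i * t i) → c = 0) :
    ∃ a : ℕ, a < M ∧ ∀ i, ∃ m : ℤ, |(a : ℝ) * t i / M - τ i - m| ≤ δ := by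
  by_contra hcon
  push Not at hcon
  -- `hcon : ∀ a < M, ∃ i, ∀ m : ℤ, δ < |a t i / M - τ i - m|`
  have hLpos : 0 < L := by
    rcases Nat.eq_zero_or_pos L with h | h
    · rw [h, Nat.cast_zero, mul_zero] at hL
      exact absurd hL (not_lt.2 (Nat.cast_nonneg _))
    · exact h
  set n := Fintype.card ι with hn
  -- the weights
  set D : ι → ℕ → ℂ := fun i a => ∑ j ∈ range L, e (j * ((a : ℝ) * t i / M - τ i)) with hD
  set W : ℕ → ℝ := fun a => ‖∏ i, D i a‖ ^ 2 with hW
  have hW0 : ∀ a, 0 ≤ W a := fun a => by positivity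
  -- total mass
  have hmass : ∑ a ∈ range M, W a = (M : ℝ) * (L : ℝ) ^ n :=
    mass_eq M hM t τ L hLpos hnorel Finset.univ
  -- bad mass for each coordinate
  have hbad : ∀ i₀ : ι, ∑ a ∈ range M, (if ∀ m : ℤ, δ < |(a : ℝ) * t i₀ / M - τ i₀ - m| then W a else 0) ≤
      1 / (4 * δ ^ 2) * ((M : ℝ) * (L : ℝ) ^ (n - 1)) := by
    intro i₀
    have hmass' := mass_eq M hM t τ L hLpos hnorel (Finset.univ.erase i₀)
    rw [Finset.card_erase_of_mem (Finset.mem_univ i₀), Finset.card_univ] at hmass'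
    rw [← hmass', Finset.mul_sum]
    refine Finset.sum_le_sum fun a _ => ?_
    have hsplit : W a = ‖D i₀ a‖ ^ 2 * ‖∏ i ∈ Finset.univ.erase i₀, D i a‖ ^ 2 := by
      rw [hW]
      simp only
      rw [← Finset.mul_prod_erase Finset.univ (fun i => D i a) (Finset.mem_univ i₀), norm_mul, mul_pow]
    split_ifs with hfar
    · rw [hsplit]
      have hDle : ‖D i₀ a‖ ≤ 1 / (2 * δ) := by
        have := norm_sum_range_e_le_inv hδ hfar L
        simpa [hD] using this
      have hD2 : ‖D i₀ a‖ ^ 2 ≤ 1 / (4 * δ ^ 2) := by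
        calc ‖D i₀ a‖ ^ 2 ≤ (1 / (2 * δ)) ^ 2 := pow_le_pow_left₀ (norm_nonneg _) hDle 2
          _ = 1 / (4 * δ ^ 2) := by field_simp; ring
      exact mul_le_mul_of_nonneg_right hD2 (by positivity)
    · positivity
  -- union bound
  have hunion : ∑ a ∈ range M, W a ≤
      ∑ i₀ : ι, ∑ a ∈ range M, (if ∀ m : ℤ, δ < |(a : ℝ) * t i₀ / M - τ i₀ - m| then W a else 0) := by
    rw [Finset.sum_comm]
    refine Finset.sum_le_sum fun a ha => ?_
    obtain ⟨i₀, hi₀⟩ := hcon a (Finset.mem_range.1 ha)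
    calc W a = (if ∀ m : ℤ, δ < |(a : ℝ) * t i₀ / M - τ i₀ - m| then W a else 0) := by rw [if_pos hi₀]
      _ ≤ ∑ i : ι, (if ∀ m : ℤ, δ < |(a : ℝ) * t i / M - τ i - m| then W a else 0) :=
          Finset.single_le_sum (f := fun i => if ∀ m : ℤ, δ < |(a : ℝ) * t i / M - τ i - m| then W a else 0)
            (fun i _ => by positivity) (Finset.mem_univ i₀)
  have hle : (M : ℝ) * (L : ℝ) ^ n ≤ n * (1 / (4 * δ ^ 2) * ((M : ℝ) * (L : ℝ) ^ (n - 1))) := by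
    calc (M : ℝ) * (L : ℝ) ^ n = ∑ a ∈ range M, W a := hmass.symm
      _ ≤ ∑ i₀ : ι, ∑ a ∈ range M,
            (if ∀ m : ℤ, δ < |(a : ℝ) * t i₀ / M - τ i₀ - m| then W a else 0) := hunion
      _ ≤ ∑ _i₀ : ι, 1 / (4 * δ ^ 2) * ((M : ℝ) * (L : ℝ) ^ (n - 1)) := Finset.sum_le_sum fun i _ => hbad i
      _ = n * (1 / (4 * δ ^ 2) * ((M : ℝ) * (L : ℝ) ^ (n - 1))) := by
          rw [Finset.sum_const, Finset.card_univ, nsmul_eq_mul]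
  -- contradiction with `n < 4 δ² L`
  have hMR : (0 : ℝ) < M := by exact_mod_cast hM
  have hLR : (0 : ℝ) < L := by exact_mod_cast hLpos
  rcases Nat.eq_zero_or_pos n with hn0 | hnpos
  · rw [hn0, pow_zero, Nat.cast_zero, zero_mul, mul_one] at hle
    linarith
  · obtain ⟨n', hn'⟩ : ∃ n', n = n' + 1 := ⟨n - 1, by omega⟩
    rw [hn', Nat.add_sub_cancel, pow_succ] at hle
    have hpos : (0 : ℝ) < (M : ℝ) * (L : ℝ) ^ n' := by positivity
    -- `M L^{n'} L ≤ (n'+1) M L^{n'} / (4δ²)` ⇒ `4 δ² L ≤ n' + 1 = n`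
    have h4 : (0 : ℝ) < 4 * δ ^ 2 := by positivity
    have : (L : ℝ) ≤ ((n' + 1 : ℕ) : ℝ) * (1 / (4 * δ ^ 2)) := by
      by_contra hlt
      rw [not_le] at hlt
      have := mul_lt_mul_of_pos_left hlt hpos
      nlinarith
    have hL' : ((n' + 1 : ℕ) : ℝ) < 4 * δ ^ 2 * L := by rw [← hn', hn]; exact hL
    rw [mul_one_div, le_div_iff₀ h4] at this
    linarith

end Summit.QuantumAdvantage.DigitPolyUniformity.SketchLAR.Chirp

end
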